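import Summits.ValiantsHypothesis.ValiantsHypothesis.Theorems.SymPencilPerFourExoticElemRankEight
import Summits.ValiantsHypothesis.ValiantsHypothesis.Theorems.SymPencilPerFourSixDimCross

/-!
# Route `SymPencil` — LEAF 3 (`stub_exoticNoSixSquares`) of the SING-SIX classification: the
# exotic six-dimensional singular subspaces `V_λ`, `V^gr` (and their transposes) carry NO
# per-direction family of `≤ 6` squares (`--supports` stmt-ValiantsHypothesis-5674
# `SdcSuperquadratic`; V-side LIST of cell `(10,6,6)`; rung currency only, nothing here bears on
# `VP ≠ VNP`)

**Theorem** (`stub_exoticNoSixSquares`, the statement of leaf 3 of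
`Cruxes/SdcSuperquadratic/Lines/sing_six_classification.lean` with `VLambdaRows`, `VGraphRows`,
`VLambdaCols`, `VGraphCols`, `PerDirSix` unfolded).  Over a field of characteristic `0`, if `W` is
(up to `S₄ × S₄`, resp. transposed) `V_λ = row ⊕ K(αe₀+βe₁) ⊕ K(αe₀−βe₁)` (`αβ ≠ 0`) or
`V^gr = row ⊕ K(E_{·0}+c₀E_{·'0}) ⊕ K(E_{·1}−c₀E_{·'1})` (`c₀ ≠ 0`), then NOT every `y ∈ W` has the
`s²`-coefficient of `per_4 (u + s y)` a combination of `≤ 6` squares of linear functionals of `u`.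

Proof.  `W` contains a permuted (resp. transposed-permuted) copy of the exotic element
`Y₀(a,b,c,d) = E₁₀+E₁₂+E₁₃+aE₂₀+bE₂₁+cE₃₀+dE₃₁` with `(a,b,c,d) = (α,β,α,−β)` resp.
`(1,1,c₀,−c₀)` (`d ≠ 0`, `ad − bc = −2αβ` resp. `−2c₀ ≠ 0`), whose Hessian has rank `8`
(`SymPencilPerFourExoticElemRankEight.not_sqFamilySwap_exoticElem`); the swapped property moves
along row/column permutations and transposition
(`SymPencilPerFourSixDimCross.sum_sq_swap_map_point`, `transport_rows`, `transport_cols`).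

Honest framing: one leaf of the LIST (leaves 1, 5 and the ten residue stubs of leaf 2 remain at
the time of writing; leaf 4 is `SymPencilPerFourCrossFilter`); `27 ≤ sdc(per₄) ≤ 29` unchanged,
stmt-5674 open, `VP ≠ VNP` not moved, no summit statement is proved here.  No definitions, no named
facts. [folklore]
-/

noncomputable section

-- single-conjunct layout: Sub = Summit, duplicated namespace component intended
set_option linter.dupNamespace false

namespace Summit.ValiantsHypothesis.ValiantsHypothesis.Theorems.SymPencilPerFourExoticNoSixSquares

open Matrix MvPolynomial Finset Module
open Literature.Computability.AlgebraicComplexity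
open Summit.ValiantsHypothesis.ValiantsHypothesis.Theorems.SymPencilPerFourBlocks
open Summit.ValiantsHypothesis.ValiantsHypothesis.Theorems.SymPencilPerFourTwoRowsRadical
open Summit.ValiantsHypothesis.ValiantsHypothesis.Theorems.SymPencilPerFourSixDimCross
open Summit.ValiantsHypothesis.ValiantsHypothesis.Theorems.SymPencilPerFourExoticElemRankEight

variable {K : Type*} [Field K]

/-! ### Transport of the swapped property to a normalised position -/

/-- **Row/column permutations**: the swapped property at `y` gives it at
`(i, j) ↦ y (ρ i, γ j)`. [folklore] -/
theorem transport_rows {ι : Type*} [Fintype ι] (ρ γ : Equiv.Perm (Fin 4))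
    {y : Fin 4 × Fin 4 → K}
    (h : ∃ (c : ι → K) (Λ : ι → ((Fin 4 × Fin 4 → K) →ₗ[K] K)),
      ∀ u : Fin 4 × Fin 4 → K, ∃ e₀ e₁ : K, ∀ s : K,
        eval (u + s • y) (perPoly (Fin 4) K) = e₀ + s * e₁ + s ^ 2 * ∑ k, c k * (Λ k u) ^ 2) :
    ∃ (c : ι → K) (Λ : ι → ((Fin 4 × Fin 4 → K) →ₗ[K] K)),
      ∀ u : Fin 4 × Fin 4 → K, ∃ e₀ e₁ : K, ∀ s : K,
        eval (u + s • (fun p : Fin 4 × Fin 4 => y (ρ p.1, γ p.2))) (perPoly (Fin 4) K) =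
          e₀ + s * e₁ + s ^ 2 * ∑ k, c k * (Λ k u) ^ 2 := by
  set Φ : (Fin 4 × Fin 4 → K) ≃ₗ[K] (Fin 4 × Fin 4 → K) :=
    LinearEquiv.funCongrLeft K K (Equiv.prodCongr ρ γ) with hΦ
  have hΦy : Φ y = fun p : Fin 4 × Fin 4 => y (ρ p.1, γ p.2) := by
    funext p
    obtain ⟨i, j⟩ := p
    rfl
  have h' := sum_sq_swap_map_point Φ (fun z => eval_perPoly_comp_prodCongr ρ γ z) h
  rwa [hΦy] at h'

/-- **Transposition composed with permutations**: the swapped property at `y` gives it at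
`(i, j) ↦ y (ρ j, γ i)`. [folklore] -/
theorem transport_cols {ι : Type*} [Fintype ι] (ρ γ : Equiv.Perm (Fin 4))
    {y : Fin 4 × Fin 4 → K}
    (h : ∃ (c : ι → K) (Λ : ι → ((Fin 4 × Fin 4 → K) →ₗ[K] K)),
      ∀ u : Fin 4 × Fin 4 → K, ∃ e₀ e₁ : K, ∀ s : K,
        eval (u + s • y) (perPoly (Fin 4) K) = e₀ + s * e₁ + s ^ 2 * ∑ k, c k * (Λ k u) ^ 2) :
    ∃ (c : ι → K) (Λ : ι → ((Fin 4 × Fin 4 → K) →ₗ[K] K)),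
      ∀ u : Fin 4 × Fin 4 → K, ∃ e₀ e₁ : K, ∀ s : K,
        eval (u + s • (fun p : Fin 4 × Fin 4 => y (ρ p.2, γ p.1))) (perPoly (Fin 4) K) =
          e₀ + s * e₁ + s ^ 2 * ∑ k, c k * (Λ k u) ^ 2 := by
  set e : Fin 4 × Fin 4 ≃ Fin 4 × Fin 4 :=
    (Equiv.prodComm (Fin 4) (Fin 4)).trans (Equiv.prodCongr ρ γ) with he
  set Φ : (Fin 4 × Fin 4 → K) ≃ₗ[K] (Fin 4 × Fin 4 → K) := LinearEquiv.funCongrLeft K K e with hΦ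
  have hΦy : Φ y = fun p : Fin 4 × Fin 4 => y (ρ p.2, γ p.1) := by
    funext p
    obtain ⟨i, j⟩ := p
    rfl
  have hΦinv : ∀ z : Fin 4 × Fin 4 → K,
      eval (Φ z) (perPoly (Fin 4) K) = eval z (perPoly (Fin 4) K) := by
    intro z
    have h1 : Φ z = LinearEquiv.funCongrLeft K K (Equiv.prodComm (Fin 4) (Fin 4))
        (z ∘ (Equiv.prodCongr ρ γ)) := by
      funext p
      obtain ⟨i, j⟩ := p
      rfl
    rw [h1, eval_perPoly_transpose, eval_perPoly_comp_prodCongr]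
  have h' := sum_sq_swap_map_point Φ hΦinv h
  rwa [hΦy] at h'

/-! ### The four exotic types -/

section Types

variable [CharZero K] (W : Submodule K (Fin 4 × Fin 4 → K))
  (hP : ∀ y ∈ W, ∃ (c : Fin 6 → K) (Λ : Fin 6 → ((Fin 4 × Fin 4 → K) →ₗ[K] K)),
    ∀ u : Fin 4 × Fin 4 → K, ∃ e₀ e₁ : K, ∀ s : K,
      eval (u + s • y) (perPoly (Fin 4) K) = e₀ + s * e₁ + s ^ 2 * ∑ k, c k * (Λ k u) ^ 2)

include hP

/-- `V_λ` (rows): contains the permuted exotic element `Y₀(α, β, α, −β)`. [folklore] -/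
theorem false_of_vLambdaRows (ρ γ : Equiv.Perm (Fin 4)) (α β : K) (hα : α ≠ 0) (hβ : β ≠ 0)
    (hW : ∀ x : Fin 4 × Fin 4 → K, x ∈ W ↔
      ((∀ j, x (ρ 0, j) = 0) ∧
       (∃ s : K, ∀ j, x (ρ 2, γ j) = s * ![α, β, 0, 0] j) ∧
       (∃ t : K, ∀ j, x (ρ 3, γ j) = t * ![α, -β, 0, 0] j))) : False := by
  classical
  set Y₀ : Fin 4 × Fin 4 → K := fun p =>
    if p = (1, 0) then (1 : K) else if p = (1, 2) then 1 else if p = (1, 3) then 1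
    else if p = (2, 0) then α else if p = (2, 1) then β
    else if p = (3, 0) then α else if p = (3, 1) then -β else 0 with hY₀
  set x : Fin 4 × Fin 4 → K := fun p => Y₀ (ρ.symm p.1, γ.symm p.2) with hx
  have hxW : x ∈ W := by
    rw [hW]
    refine ⟨fun j => ?_, ⟨1, fun j => ?_⟩, ⟨1, fun j => ?_⟩⟩
    · simp only [hx, hY₀, Equiv.symm_apply_apply, Prod.mk.injEq]
      simp
    · simp only [hx, Equiv.symm_apply_apply]
      fin_cases j <;> simp [hY₀]
    · simp only [hx, Equiv.symm_apply_apply]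
      fin_cases j <;> simp [hY₀]
  have hY : (fun p : Fin 4 × Fin 4 => x (ρ p.1, γ p.2)) = Y₀ := by
    funext p
    simp [hx]
  obtain ⟨c, Λ, h⟩ := (hY ▸ transport_rows ρ γ (hP x hxW) :)
  refine not_sqFamilySwap_exoticElem α β α (-β) (neg_ne_zero.2 hβ) ?_ (ι := Fin 6) (by simp) c Λ
    (by simpa only [hY₀] using h)
  have : α * -β - β * α = -(2 * (α * β)) := by ring
  rw [this, neg_ne_zero]
  exact mul_ne_zero two_ne_zero (mul_ne_zero hα hβ)

/-- `V^gr` (rows): contains the permuted exotic element `Y₀(1, 1, c₀, −c₀)`. [folklore] -/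
theorem false_of_vGraphRows (ρ γ : Equiv.Perm (Fin 4)) (c₀ : K) (hc₀ : c₀ ≠ 0)
    (hW : ∀ x : Fin 4 × Fin 4 → K, x ∈ W ↔
      ((∀ j, x (ρ 0, j) = 0) ∧
       x (ρ 2, γ 2) = 0 ∧ x (ρ 2, γ 3) = 0 ∧ x (ρ 3, γ 2) = 0 ∧ x (ρ 3, γ 3) = 0 ∧
       x (ρ 3, γ 0) = c₀ * x (ρ 2, γ 0) ∧ x (ρ 3, γ 1) = -(c₀ * x (ρ 2, γ 1)))) : False := by
  classical
  set Y₀ : Fin 4 × Fin 4 → K := fun p =>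
    if p = (1, 0) then (1 : K) else if p = (1, 2) then 1 else if p = (1, 3) then 1
    else if p = (2, 0) then (1 : K) else if p = (2, 1) then (1 : K)
    else if p = (3, 0) then c₀ else if p = (3, 1) then -c₀ else 0 with hY₀
  set x : Fin 4 × Fin 4 → K := fun p => Y₀ (ρ.symm p.1, γ.symm p.2) with hx
  have hxW : x ∈ W := by
    rw [hW]
    refine ⟨fun j => ?_, ?_, ?_, ?_, ?_, ?_, ?_⟩
    · simp only [hx, hY₀, Equiv.symm_apply_apply, Prod.mk.injEq]
      simp
    all_goals simp [hx, hY₀]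
  have hY : (fun p : Fin 4 × Fin 4 => x (ρ p.1, γ p.2)) = Y₀ := by
    funext p
    simp [hx]
  obtain ⟨c, Λ, h⟩ := (hY ▸ transport_rows ρ γ (hP x hxW) :)
  refine not_sqFamilySwap_exoticElem (1 : K) 1 c₀ (-c₀) (neg_ne_zero.2 hc₀) ?_ (ι := Fin 6)
    (by simp) c Λ (by simpa only [hY₀] using h)
  have : (1 : K) * -c₀ - 1 * c₀ = -(2 * c₀) := by ring
  rw [this, neg_ne_zero]
  exact mul_ne_zero two_ne_zero hc₀

/-- `V_λ` (columns): contains the transposed-permuted exotic element `Y₀(α, β, α, −β)`.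
[folklore] -/
theorem false_of_vLambdaCols (ρ γ : Equiv.Perm (Fin 4)) (α β : K) (hα : α ≠ 0) (hβ : β ≠ 0)
    (hW : ∀ x : Fin 4 × Fin 4 → K, x ∈ W ↔
      ((∀ i, x (i, γ 0) = 0) ∧
       (∃ s : K, ∀ i, x (ρ i, γ 2) = s * ![α, β, 0, 0] i) ∧
       (∃ t : K, ∀ i, x (ρ i, γ 3) = t * ![α, -β, 0, 0] i))) : False := by
  classical
  set Y₀ : Fin 4 × Fin 4 → K := fun p =>
    if p = (1, 0) then (1 : K) else if p = (1, 2) then 1 else if p = (1, 3) then 1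
    else if p = (2, 0) then α else if p = (2, 1) then β
    else if p = (3, 0) then α else if p = (3, 1) then -β else 0 with hY₀
  set x : Fin 4 × Fin 4 → K := fun p => Y₀ (γ.symm p.2, ρ.symm p.1) with hx
  have hxW : x ∈ W := by
    rw [hW]
    refine ⟨fun i => ?_, ⟨1, fun i => ?_⟩, ⟨1, fun i => ?_⟩⟩
    · simp only [hx, hY₀, Equiv.symm_apply_apply, Prod.mk.injEq]
      simp
    · simp only [hx, Equiv.symm_apply_apply]
      fin_cases i <;> simp [hY₀]
    · simp only [hx, Equiv.symm_apply_apply]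
      fin_cases i <;> simp [hY₀]
  have hY : (fun p : Fin 4 × Fin 4 => x (ρ p.2, γ p.1)) = Y₀ := by
    funext p
    simp [hx]
  obtain ⟨c, Λ, h⟩ := (hY ▸ transport_cols ρ γ (hP x hxW) :)
  refine not_sqFamilySwap_exoticElem α β α (-β) (neg_ne_zero.2 hβ) ?_ (ι := Fin 6) (by simp) c Λ
    (by simpa only [hY₀] using h)
  have : α * -β - β * α = -(2 * (α * β)) := by ring
  rw [this, neg_ne_zero]
  exact mul_ne_zero two_ne_zero (mul_ne_zero hα hβ)

/-- `V^gr` (columns): contains the transposed-permuted exotic element `Y₀(1, 1, c₀, −c₀)`.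
[folklore] -/
theorem false_of_vGraphCols (ρ γ : Equiv.Perm (Fin 4)) (c₀ : K) (hc₀ : c₀ ≠ 0)
    (hW : ∀ x : Fin 4 × Fin 4 → K, x ∈ W ↔
      ((∀ i, x (i, γ 0) = 0) ∧
       x (ρ 2, γ 2) = 0 ∧ x (ρ 3, γ 2) = 0 ∧ x (ρ 2, γ 3) = 0 ∧ x (ρ 3, γ 3) = 0 ∧
       x (ρ 0, γ 3) = c₀ * x (ρ 0, γ 2) ∧ x (ρ 1, γ 3) = -(c₀ * x (ρ 1, γ 2)))) : False := by
  classical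
  set Y₀ : Fin 4 × Fin 4 → K := fun p =>
    if p = (1, 0) then (1 : K) else if p = (1, 2) then 1 else if p = (1, 3) then 1
    else if p = (2, 0) then (1 : K) else if p = (2, 1) then (1 : K)
    else if p = (3, 0) then c₀ else if p = (3, 1) then -c₀ else 0 with hY₀
  set x : Fin 4 × Fin 4 → K := fun p => Y₀ (γ.symm p.2, ρ.symm p.1) with hx
  have hxW : x ∈ W := by
    rw [hW]
    refine ⟨fun i => ?_, ?_, ?_, ?_, ?_, ?_, ?_⟩
    · simp only [hx, hY₀, Equiv.symm_apply_apply, Prod.mk.injEq]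
      simp
    all_goals simp [hx, hY₀]
  have hY : (fun p : Fin 4 × Fin 4 => x (ρ p.2, γ p.1)) = Y₀ := by
    funext p
    simp [hx]
  obtain ⟨c, Λ, h⟩ := (hY ▸ transport_cols ρ γ (hP x hxW) :)
  refine not_sqFamilySwap_exoticElem (1 : K) 1 c₀ (-c₀) (neg_ne_zero.2 hc₀) ?_ (ι := Fin 6)
    (by simp) c Λ (by simpa only [hY₀] using h)
  have : (1 : K) * -c₀ - 1 * c₀ = -(2 * c₀) := by ring
  rw [this, neg_ne_zero]
  exact mul_ne_zero two_ne_zero hc₀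

end Types

/-- **LEAF 3 — THE EXOTICS CARRY NO PER-DIRECTION SIX-SQUARE FAMILY**, verbatim from
`Cruxes/SdcSuperquadratic/Lines/sing_six_classification.lean` with `VLambdaRows`, `VGraphRows`,
`VLambdaCols`, `VGraphCols`, `PerDirSix` unfolded. [folklore] -/
theorem stub_exoticNoSixSquares [CharZero K] :
    ∀ W : Submodule K (Fin 4 × Fin 4 → K),
      ((∃ (ρ γ : Equiv.Perm (Fin 4)) (α β : K), α ≠ 0 ∧ β ≠ 0 ∧
          ∀ x : Fin 4 × Fin 4 → K, x ∈ W ↔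
            ((∀ j, x (ρ 0, j) = 0) ∧
             (∃ s : K, ∀ j, x (ρ 2, γ j) = s * ![α, β, 0, 0] j) ∧
             (∃ t : K, ∀ j, x (ρ 3, γ j) = t * ![α, -β, 0, 0] j))) ∨
       (∃ (ρ γ : Equiv.Perm (Fin 4)) (c₀ : K), c₀ ≠ 0 ∧
          ∀ x : Fin 4 × Fin 4 → K, x ∈ W ↔
            ((∀ j, x (ρ 0, j) = 0) ∧
             x (ρ 2, γ 2) = 0 ∧ x (ρ 2, γ 3) = 0 ∧ x (ρ 3, γ 2) = 0 ∧ x (ρ 3, γ 3) = 0 ∧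
             x (ρ 3, γ 0) = c₀ * x (ρ 2, γ 0) ∧ x (ρ 3, γ 1) = -(c₀ * x (ρ 2, γ 1)))) ∨
       (∃ (ρ γ : Equiv.Perm (Fin 4)) (α β : K), α ≠ 0 ∧ β ≠ 0 ∧
          ∀ x : Fin 4 × Fin 4 → K, x ∈ W ↔
            ((∀ i, x (i, γ 0) = 0) ∧
             (∃ s : K, ∀ i, x (ρ i, γ 2) = s * ![α, β, 0, 0] i) ∧
             (∃ t : K, ∀ i, x (ρ i, γ 3) = t * ![α, -β, 0, 0] i))) ∨
       (∃ (ρ γ : Equiv.Perm (Fin 4)) (c₀ : K), c₀ ≠ 0 ∧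
          ∀ x : Fin 4 × Fin 4 → K, x ∈ W ↔
            ((∀ i, x (i, γ 0) = 0) ∧
             x (ρ 2, γ 2) = 0 ∧ x (ρ 3, γ 2) = 0 ∧ x (ρ 2, γ 3) = 0 ∧ x (ρ 3, γ 3) = 0 ∧
             x (ρ 0, γ 3) = c₀ * x (ρ 0, γ 2) ∧ x (ρ 1, γ 3) = -(c₀ * x (ρ 1, γ 2))))) →
      ¬ (∀ y ∈ W, ∃ (c : Fin 6 → K) (Λ : Fin 6 → ((Fin 4 × Fin 4 → K) →ₗ[K] K)),
          ∀ u : Fin 4 × Fin 4 → K, ∃ e₀ e₁ : K, ∀ s : K,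
            eval (u + s • y) (perPoly (Fin 4) K) = e₀ + s * e₁ + s ^ 2 * ∑ k, c k * (Λ k u) ^ 2) := by
  intro W hW hP
  rcases hW with ⟨ρ, γ, α, β, hα, hβ, hW⟩ | ⟨ρ, γ, c₀, hc₀, hW⟩ | ⟨ρ, γ, α, β, hα, hβ, hW⟩ |
    ⟨ρ, γ, c₀, hc₀, hW⟩
  · exact false_of_vLambdaRows W hP ρ γ α β hα hβ hW
  · exact false_of_vGraphRows W hP ρ γ c₀ hc₀ hW
  · exact false_of_vLambdaCols W hP ρ γ α β hα hβ hW
  · exact false_of_vGraphCols W hP ρ γ c₀ hc₀ hW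

end Summit.ValiantsHypothesis.ValiantsHypothesis.Theorems.SymPencilPerFourExoticNoSixSquares

end
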